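import Summits.BirchSwinnertonDyer.BirchSwinnertonDyer.Theorems.CongruentShaFreeCutBDPUpToRigidity
import Summits.BirchSwinnertonDyer.BirchSwinnertonDyer.Theorems.CongruentShaFreeCutCharacterSupply
import Summits.BirchSwinnertonDyer.BirchSwinnertonDyer.Theorems.CongruentShaFreeCutPadicSupplyRate
import HarnessLib

set_option linter.dupNamespace false -- `Summit.BirchSwinnertonDyer.BirchSwinnertonDyer.Theorems.…` (summit = sub)
set_option autoImplicit false

/-! # Route `CongruentShaFreeCut` (rung S2) — LEMMA R∞, part (i): the NON-UNIMODULAR period ratio is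
# VACUOUS: two ♯-frames `IsBDPLFunctionUpTo` of the same `(ι, 𝔭, κ, γ, f)` whose period ratio
# `β = ι⁻¹((Ω_K/Ω_K')⁴)·(Ω_p'/Ω_p)⁴` has `‖β‖ ≠ 1` are BOTH THE ZERO SERIES

Cell `bsd-cn100`, prover seat `bsd-cn100-transfer-2` (g6). Supports, does not close,
stmt-BirchSwinnertonDyer-19079 (and the S2b twin 19159 by `C = C' = 1`). Context: plan g15 RULING-4
(2026-08-27T01:22:06Z) keeps the registered research stub `stub_twoAdicWanDivisibilityUpTo` in its
∀-FRAME form and commissions LEMMA R∞ (series rigidity ACROSS periods: two admissible ♯-frames of the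
same data differ by `c·u`, `c ∈ Frac(R₀)ˣ`, `u ∈ R₀⟦T⟧ˣ`) — the surplus of the ∀-frame form over the
one-tuple form the road consumes. This file proves the EASY HALF of R∞: off the unit circle there is
nothing to transfer, because no non-zero admissible pair exists. The UNIMODULAR case `‖β‖ = 1` (the real
content of R∞: `𝓛' = c·(1+T)^s·𝓛`-type rigidity) is NOT treated here (seat `bsd-cn100-transfer`).
HONEST FRAMING: elementary `p`-adic analysis on `R₀⟦T⟧`; nothing about (LB-wan♯), the anticyclotomic
main conjecture, crux A/B, the congruent number problem or BSD is proved.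

## What is proved (any prime `p`)

* §1 = the sibling file `Theorems/CongruentShaFreeCutPadicSupplyRate.lean` (the `p`-adic helpers:
  `‖L(x)‖ ≤ 1`, `‖(1+y)^p − 1‖ = ‖p‖‖y‖`, the RATE `‖x₀^{p^k} − 1‖ = C₀·‖p‖^k` of the character supply,
  double-exponential growth, the identity principle on `R₀⟦T⟧`).
* §2 the abstract core **`eq_zero_of_values_mul_pow_of_one_lt_norm`**: if `L, L' ∈ R₀⟦T⟧` take values
  `v_k` and `c·b^{p^k}·v_k` along such `T_k` and `‖b‖ > 1`, then `L = 0` (the order lemma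
  `…X11b.Halves.norm_value_eq_of_order` gives `‖v_k‖ = C·‖p‖^{kd}` if `L ≠ 0`, while `‖L'(T_k)‖ ≤ 1`
  forces `‖b‖^{p^k} ≤ A·R^k` — impossible); and **`eq_zero_and_eq_zero_of_values_mul_pow_of_norm_ne_one`**
  (`‖b‖ ≠ 1`, `b, c ≠ 0` ⇒ `L = 0 ∧ L' = 0`, by symmetry and the identity principle).
* §3 the frame statement **`eq_zero_of_isBDPLFunctionUpTo_of_norm_ne_one`**: for `K` imaginary
  quadratic, `κ` anticyclotomic with topological generator `γ`, two tuples
  `IsBDPLFunctionUpTo C ι 𝔭 κ γ f Ω_K Ω_p L`, `IsBDPLFunctionUpTo C' ι 𝔭 κ γ f Ω_K' Ω_p' L'` (all of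
  `Ω_K, Ω_K', Ω_p, Ω_p', C, C'` non-zero) with `‖β‖ ≠ 1`: `L = 0 ∧ L' = 0` — via the cell's character
  supply `CongruentShaFreeCutCharacterSupply.characterSupplyAt` (every `p`) and transfer g11's
  `CongruentShaFreeCutBDPUpToRigidity.hasValueAt_frameUpTo_rescale` (`L'(T_φ) = (C'/C)·β^n·L(T_φ)`).
  So the R∞ surplus of the ∀-frame stubs lives ENTIRELY on the unit circle `‖β‖ = 1`.

References: [Castella2018] Thm. 3.1 (arXiv:1704.06608 p. 9; the interpolation shape);
[CastellaHsieh2018] §3.3, Def. 3.5, Prop. 3.6 (the constants outside the display); [Cassels1986]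
J. W. S. Cassels, *Local Fields*, Ch. 4 (values and zeros of power series on the open disc);
[Washington1997] §5.1 (`‖(1+y)^p − 1‖ = ‖p‖‖y‖` near `1`). -/

noncomputable section

open scoped Classical Topology

open Filter PowerSeries NumberField IsDedekindDomain Field
open Literature.NumberTheory.GaloisRepresentations Literature.NumberTheory.EllipticCurves

namespace Summit.BirchSwinnertonDyer.BirchSwinnertonDyer.Theorems.CongruentShaFreeCutBDPUpToNonUnimodular

open Summit.BirchSwinnertonDyer.Rank1Residual.X11b.Halves
open Summit.BirchSwinnertonDyer.BirchSwinnertonDyer.Theorems.CongruentShaFreeCutBDPUpToRigidity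
  (hasValueAt_frameUpTo_rescale)
open Summit.BirchSwinnertonDyer.BirchSwinnertonDyer.Theorems.CongruentShaFreeCutCharacterSupply
  (characterSupplyAt)
open Summit.BirchSwinnertonDyer.BirchSwinnertonDyer.Theorems.CongruentShaFreeCutPadicSupplyRate

variable {p : ℕ} [Fact p.Prime]

/-! ### §2 The abstract core: values tied by `c · b^{p^k}` along the supply points -/

/-- **Abstract core, `‖b‖ > 1`.** Let `L, L' ∈ R₀⟦T⟧` take the values `v_k` and `c·b^{p^k}·v_k` at
points `T_k → 0` with `‖T_k‖ = C₀·‖p‖^k` for `k ≥ k₀` (`C₀ > 0`), where `c ≠ 0` and `‖b‖ > 1`. Then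
`L = 0`. PROOF: if `L ≠ 0` has order `d` and `g₀ = [T^d]L ≠ 0`, the order lemma gives
`‖v_k‖ = ‖T_k‖^d·‖g₀‖ = C₀^d‖g₀‖·(‖p‖^d)^k` for large `k`, while `‖c·b^{p^k}·v_k‖ = ‖L'(T_k)‖ ≤ 1`; hence
`‖b‖^{p^k} ≤ A·R^k` with `A = (‖c‖C₀^d‖g₀‖)⁻¹`, `R = (‖p‖^d)⁻¹` — contradicting double-exponential growth.
[cite: Cassels1986, Ch. 4 Lemma 2.1] -/
theorem eq_zero_of_values_mul_pow_of_one_lt_norm {L L' : UnrSeries p} {T v : ℕ → ℂ_[p]}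
    {c b : ℂ_[p]} {k₀ : ℕ} {C₀ : ℝ} (hC₀ : 0 < C₀)
    (hrate : ∀ k : ℕ, k₀ ≤ k → ‖T k‖ = C₀ * ‖(p : ℂ_[p])‖ ^ k) (hT0 : Tendsto T atTop (𝓝 0))
    (hv : ∀ k, L.HasValueAt (T k) (v k))
    (hv' : ∀ k, L'.HasValueAt (T k) (c * b ^ p ^ k * v k)) (hc : c ≠ 0) (hb : 1 < ‖b‖) :
    L = 0 := by
  have hp : p.Prime := Fact.out
  have hpnorm : 0 < ‖(p : ℂ_[p])‖ := norm_pos_iff.mpr (by exact_mod_cast hp.ne_zero)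
  by_contra hne
  set d : ℕ := L.order.toNat with hd
  set g₀ : ℂ_[p] := ((PowerSeries.coeff d L : unrIntegers p) : ℂ_[p]) with hg₀
  have hg₀ne : g₀ ≠ 0 := by
    rw [hg₀, Ne, ZeroMemClass.coe_eq_zero, hd]
    exact PowerSeries.coeff_order hne
  have hg₀pos : 0 < ‖g₀‖ := norm_pos_iff.mpr hg₀ne
  -- the constants of the exponential bound
  set A : ℝ := (‖c‖ * (C₀ ^ d * ‖g₀‖))⁻¹ with hA
  set R : ℝ := (‖(p : ℂ_[p])‖ ^ d)⁻¹ with hR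
  have hApos : 0 < A := inv_pos.mpr (mul_pos (norm_pos_iff.mpr hc) (mul_pos (pow_pos hC₀ d) hg₀pos))
  have hRpos : 0 < R := inv_pos.mpr (pow_pos hpnorm d)
  obtain ⟨k₁, hk₁⟩ := exists_lt_pow_prime_pow (p := p) hb hApos.le hRpos.le
  -- a large index where everything holds
  have hTn : Tendsto (fun k ↦ ‖T k‖) atTop (𝓝 0) := tendsto_zero_iff_norm_tendsto_zero.mp hT0
  have E1 : ∀ᶠ k in atTop, ‖T k‖ < 1 := hTn.eventually_lt_const zero_lt_one
  have E2 : ∀ᶠ k in atTop, ‖T k‖ < ‖g₀‖ := hTn.eventually_lt_const hg₀pos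
  have E3 : ∀ᶠ k in atTop, k₀ ≤ k := eventually_ge_atTop k₀
  have E4 : ∀ᶠ k in atTop, k₁ ≤ k := eventually_ge_atTop k₁
  obtain ⟨k, h1, h2, h3, h4⟩ := (E1.and (E2.and (E3.and E4))).exists
  -- `‖v_k‖ = ‖T_k‖^d ‖g₀‖`
  have hvk : ‖v k‖ = ‖T k‖ ^ d * ‖g₀‖ := norm_value_eq_of_order h1 h2 (hv k)
  -- `‖c b^{p^k} v_k‖ ≤ 1`
  have hle : ‖c * b ^ p ^ k * v k‖ ≤ 1 := norm_value_le_one h1 (hv' k)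
  rw [norm_mul, norm_mul, norm_pow, hvk, hrate k h3] at hle
  -- rewrite as `‖b‖^{p^k} ≤ A R^k`
  have hprod : ‖c‖ * (C₀ ^ d * ‖g₀‖) * ((‖(p : ℂ_[p])‖ ^ d) ^ k * ‖b‖ ^ p ^ k) ≤ 1 := by
    have : ‖c‖ * ‖b‖ ^ p ^ k * ((C₀ * ‖(p : ℂ_[p])‖ ^ k) ^ d * ‖g₀‖) =
        ‖c‖ * (C₀ ^ d * ‖g₀‖) * ((‖(p : ℂ_[p])‖ ^ d) ^ k * ‖b‖ ^ p ^ k) := by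
      rw [mul_pow, ← pow_mul, ← pow_mul, mul_comm k d]; ring
    rw [← this]; exact hle
  have hK : 0 < ‖c‖ * (C₀ ^ d * ‖g₀‖) := mul_pos (norm_pos_iff.mpr hc) (mul_pos (pow_pos hC₀ d) hg₀pos)
  have hPk : 0 < (‖(p : ℂ_[p])‖ ^ d) ^ k := pow_pos (pow_pos hpnorm d) k
  have hKP : 0 < ‖c‖ * (C₀ ^ d * ‖g₀‖) * (‖(p : ℂ_[p])‖ ^ d) ^ k := mul_pos hK hPk
  have hmul : ‖b‖ ^ p ^ k * (‖c‖ * (C₀ ^ d * ‖g₀‖) * (‖(p : ℂ_[p])‖ ^ d) ^ k) ≤ 1 := by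
    calc ‖b‖ ^ p ^ k * (‖c‖ * (C₀ ^ d * ‖g₀‖) * (‖(p : ℂ_[p])‖ ^ d) ^ k)
        = ‖c‖ * (C₀ ^ d * ‖g₀‖) * ((‖(p : ℂ_[p])‖ ^ d) ^ k * ‖b‖ ^ p ^ k) := by ring
      _ ≤ 1 := hprod
  have hbk : ‖b‖ ^ p ^ k ≤ A * R ^ k := by
    rw [hA, hR, inv_pow, ← mul_inv, ← one_div]
    exact (le_div_iff₀ hKP).mpr hmul
  exact (not_lt.mpr hbk) (hk₁ k h4)

/-- **Abstract core, both signs**: with the data of `eq_zero_of_values_mul_pow_of_one_lt_norm` but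
`‖b‖ ≠ 1`, `b ≠ 0`, `c ≠ 0`, and `T_k ≠ 0` above `k₀`: BOTH `L = 0` and `L' = 0`. (For `‖b‖ < 1` swap
the roles — `v_k = c⁻¹·(b⁻¹)^{p^k}·(c b^{p^k} v_k)` —; the other series then vanishes along `T_k` and is
`0` by the identity principle.) [cite: Cassels1986, Ch. 4 Lemma 2.1] -/
theorem eq_zero_and_eq_zero_of_values_mul_pow_of_norm_ne_one {L L' : UnrSeries p}
    {T v : ℕ → ℂ_[p]} {c b : ℂ_[p]} {k₀ : ℕ} {C₀ : ℝ} (hC₀ : 0 < C₀)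
    (hrate : ∀ k : ℕ, k₀ ≤ k → ‖T k‖ = C₀ * ‖(p : ℂ_[p])‖ ^ k) (hT0 : Tendsto T atTop (𝓝 0))
    (hv : ∀ k, L.HasValueAt (T k) (v k))
    (hv' : ∀ k, L'.HasValueAt (T k) (c * b ^ p ^ k * v k)) (hc : c ≠ 0) (hb0 : b ≠ 0)
    (hb : ‖b‖ ≠ 1) : L = 0 ∧ L' = 0 := by
  have hp : p.Prime := Fact.out
  have hpnorm : 0 < ‖(p : ℂ_[p])‖ := norm_pos_iff.mpr (by exact_mod_cast hp.ne_zero)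
  have hTne : ∀ k, k₀ ≤ k → T k ≠ 0 := fun k hk ↦ by
    rw [← norm_pos_iff, hrate k hk]; exact mul_pos hC₀ (pow_pos hpnorm k)
  rcases hb.lt_or_gt with hlt | hgt
  · -- `‖b‖ < 1`: `L' = 0` by the core with the roles swapped, then `L = 0`
    have hb' : 1 < ‖b⁻¹‖ := by rw [norm_inv]; exact (one_lt_inv₀ (norm_pos_iff.mpr hb0)).mpr hlt
    have hvv : ∀ k, L.HasValueAt (T k) (c⁻¹ * b⁻¹ ^ p ^ k * (c * b ^ p ^ k * v k)) := by
      intro k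
      have e : c⁻¹ * b⁻¹ ^ p ^ k * (c * b ^ p ^ k * v k) = v k := by
        rw [inv_pow]; field_simp
      rw [e]; exact hv k
    have hL' : L' = 0 :=
      eq_zero_of_values_mul_pow_of_one_lt_norm hC₀ hrate hT0 hv' hvv (inv_ne_zero hc) hb'
    refine ⟨?_, hL'⟩
    -- the values `c b^{p^k} v_k` of `L' = 0` vanish, so `v_k = 0`
    refine eq_zero_of_hasValueAt_zero hT0 hTne fun k _ ↦ ?_
    have h0 : c * b ^ p ^ k * v k = 0 := by
      have h := hv' k
      rw [hL'] at h
      exact h.unique (hasValueAt_zero_series (T k))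
    have hvk : v k = 0 := by
      rcases mul_eq_zero.mp h0 with h | h
      · rcases mul_eq_zero.mp h with h | h
        · exact absurd h hc
        · exact absurd (pow_eq_zero_iff'.mp h).1 hb0
      · exact h
    simpa [hvk] using hv k
  · -- `‖b‖ > 1`
    have hL : L = 0 := eq_zero_of_values_mul_pow_of_one_lt_norm hC₀ hrate hT0 hv hv' hc hgt
    refine ⟨hL, ?_⟩
    refine eq_zero_of_hasValueAt_zero hT0 hTne fun k _ ↦ ?_
    have hvk : v k = 0 := by
      have h := hv k
      rw [hL] at h
      exact h.unique (hasValueAt_zero_series (T k))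
    simpa [hvk] using hv' k

/-! ### §3 The frame statement: non-unimodular period ratios carry no ♯-frame -/

/-- **LEMMA R∞, part (i) — NON-UNIMODULAR EXCLUSION.** Let `K` be imaginary quadratic, `κ` an
anticyclotomic `ℤ_p`-extension datum with topological generator `γ`, and
`IsBDPLFunctionUpTo C ι 𝔭 κ γ f Ω_K Ω_p L`, `IsBDPLFunctionUpTo C' ι 𝔭 κ γ f Ω_K' Ω_p' L'` two ♯-frames
of the SAME `(ι, 𝔭, κ, γ, f)` with `Ω_K, Ω_K', Ω_p, Ω_p', C, C'` non-zero. If the period ratio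
`β = ι⁻¹((Ω_K/Ω_K')⁴)·(Ω_p'/Ω_p)⁴` has `‖β‖ ≠ 1`, then `L = 0` AND `L' = 0`. Proof: on the cell's
character supply (`characterSupplyAt`: `φ_k` of type `(m p^k, −m p^k)`, values `x₀^{p^k}` at `γ`,
`x₀` non-torsion, `x₀^{p^k} → 1`) the two frames' values are tied by `(C'/C)·(β^m)^{p^k}`
(`hasValueAt_frameUpTo_rescale`), the points `T_k = x₀^{p^k} − 1` have the rate `C₀·‖p‖^k`, and §2
applies with `b = β^m`, `‖b‖ = ‖β‖^m ≠ 1`. Consequence for the registered ∀-frame stubs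
(`TwoAdicWanDivisibilityUpTo`, `ThreeAdicWanDivisibility`): their surplus over the one-frame form (plan
g15 RULING-4: LEMMA R∞) is VACUOUS off the unit circle `‖β‖ = 1`. [cite: Castella2018, Thm. 3.1 (arXiv:1704.06608 p. 9)]
[cite: CastellaHsieh2018, §3.3, Def. 3.5 and Prop. 3.6] [cite: Cassels1986, Ch. 4 Lemma 2.1] -/
theorem eq_zero_of_isBDPLFunctionUpTo_of_norm_ne_one (K : Type) [Field K] [NumberField K] (N : ℕ)
    (ι : PadicAlgCl p ≃+* ℂ) (𝔭 : HeightOneSpectrum (𝓞 K)) (κ : ZpExtension K p)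
    (γ : Field.absoluteGaloisGroup K) (f : CuspForm (CongruenceSubgroup.Gamma0 N) 2) (ΩK ΩK' : ℂ)
    (Ωp Ωp' C C' : ℂ_[p]) (L L' : UnrSeries p) (hK : IsImaginaryQuadratic K)
    (hκ : κ.IsAnticyclotomic) (hγ : κ.IsTopGenerator γ)
    (hΩK : ΩK ≠ 0) (hΩK' : ΩK' ≠ 0) (hΩp : Ωp ≠ 0) (hΩp' : Ωp' ≠ 0) (hC : C ≠ 0) (hC' : C' ≠ 0)
    (hL : IsBDPLFunctionUpTo C ι 𝔭 κ γ f ΩK Ωp L)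
    (hL' : IsBDPLFunctionUpTo C' ι 𝔭 κ γ f ΩK' Ωp' L')
    (hβ : ‖((ι.symm ((ΩK / ΩK') ^ 4) : PadicAlgCl p) : ℂ_[p]) * (Ωp' / Ωp) ^ 4‖ ≠ 1) :
    L = 0 ∧ L' = 0 := by
  have hp : p.Prime := Fact.out
  obtain ⟨m, x₀, φ, -, r, -, hm, hx1, hx, hunr, hinf, hr, hrκ, hval, -⟩ :=
    characterSupplyAt (p := p) K ι κ γ hK hκ hγ
  -- the points and their rate
  set T : ℕ → ℂ_[p] := fun k ↦ x₀ ^ p ^ k - 1 with hT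
  have hT0 : Tendsto T atTop (𝓝 0) := by
    have h := hx.sub_const 1
    rwa [sub_self] at h
  obtain ⟨k₀, C₀, hC₀, hrate⟩ := exists_norm_pow_prime_pow_sub_one_eq (p := p) hx1 hx
  -- the period ratio and the constant
  set β : ℂ_[p] := ((ι.symm ((ΩK / ΩK') ^ 4) : PadicAlgCl p) : ℂ_[p]) * (Ωp' / Ωp) ^ 4 with hβdef
  have hβ0 : β ≠ 0 := by
    refine mul_ne_zero ?_ (pow_ne_zero _ (div_ne_zero hΩp' hΩp))
    rw [PadicComplex.coe_eq]
    exact (map_ne_zero_iff _ (algebraMap (PadicAlgCl p) ℂ_[p]).injective).mpr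
      ((map_ne_zero_iff _ ι.symm.injective).mpr (pow_ne_zero _ (div_ne_zero hΩK hΩK')))
  have hbnorm : ‖β ^ m‖ ≠ 1 := by
    rw [norm_pow]
    intro h
    exact hβ ((pow_eq_one_iff_of_nonneg (norm_nonneg β) hm.ne').mp h)
  -- exponents positive
  have hn : ∀ k, 0 < m * p ^ k := fun k ↦ Nat.mul_pos hm (pow_pos hp.pos k)
  -- values of the first frame
  set v : ℕ → ℂ_[p] := fun k ↦
    C * (((ι.symm (bdpInterpolationValue p f 𝔭 (φ k) (m * p ^ k) ΩK) : PadicAlgCl p) : ℂ_[p]) *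
      Ωp ^ (4 * (m * p ^ k))) with hv
  have hLv : ∀ k, L.HasValueAt (T k) (v k) := by
    intro k
    have h := hL.hasValueAt (hn k) (hunr k) (hinf k) (hr k) (hrκ k)
    rwa [hval k] at h
  -- values of the second frame: `(C'/C)·β^{m p^k}·v_k = (C'/C)·(β^m)^{p^k}·v_k`
  have hL'v : ∀ k, L'.HasValueAt (T k) (C' / C * (β ^ m) ^ p ^ k * v k) := by
    intro k
    have h := hasValueAt_frameUpTo_rescale hΩK hΩK' hΩp hC hL' (hn k) (hunr k) (hinf k) (hr k) (hrκ k)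
    rw [hval k, pow_mul] at h
    exact h
  exact eq_zero_and_eq_zero_of_values_mul_pow_of_norm_ne_one hC₀ hrate hT0 hLv hL'v
    (div_ne_zero hC' hC) (pow_ne_zero _ hβ0) hbnorm

end Summit.BirchSwinnertonDyer.BirchSwinnertonDyer.Theorems.CongruentShaFreeCutBDPUpToNonUnimodular

end
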